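import Summits.QuantumFields.BalabanUV.Beta.GAN24.BornLambdaUndressedRow
import Summits.QuantumFields.BalabanUV.Beta.GAN24.S3DiffLAt
import Summits.QuantumFields.BalabanUV.Beta.GAN24.S3DiffLtAt

/-!
# `BalabanUV.Beta.GAN24.BornLambdaUndressedDrift` — binder row G-an2-4 ∕ (CONV-C), CT-ROUTE (R8°), THE RATE HALF OF THE Λ-BORN ROW: **THE UNDRESSED TOP-ALIGNED
# PAIR LETTER OF THE `d = 3` COMB FAMILY, BIRTHS `≥ 1`, IN SUP CURRENCY** — the one-step difference of the weighted UNDRESSED Λ-lineages (member `j+n+3` born at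
# `j+2` against member `j+n+2` born at `j+1`, same weight `(cE·Lc^8)^{n+1}`) is `Lc^4 ×` road S3's ROOTED DIFF rows (`S3DiffLAt.diffL_three_at` for `n ≥ 1`,
# `S3DiffLtAt.diffLt_three_at` for `n = 0`) by the owner's Q22 exponent identities `BornLambdaUndressedRow.lineage_succ_pin_apply` ∕ `lineage_top_pin_apply` at BOTH
# members; hence `≤ CU·Θ^{j+n+1}` with ONE `CU`, ONE `0 < Θ < 1`, for all in-block roots

NOT IN PRINT; OUR BOOKKEEPING (G-an2-4 formalisation swarm → CRUX TEAM (2), leaf prover `b2b-balaban-gan24-formalise-leaf-06`, gen 41; «ROOTED-S3-Λ-DIFF» junction;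
the socket = `GAN24/BornLambdaDriftSup.exists_hBdevLam_three_of_supPairs`).  HONEST FRAMING (cell contract, verbatim): «discharging `BetaPertH` makes Bałaban's UV
stability UNCONDITIONAL — a real constructive-QFT result; it is NOT the continuum limit and NOT the Clay problem.»  HONEST DEPENDENCY (verbatim): «continuum YM on T⁴ ⇐
BetaPertH ∧ nine spine estimates (0/9 proved); BetaPertH ⇐ (D1) ∧ (D4) ∧ CAP+tail; G-an2-4 gates asym, D1 and NE2/3/4.»  [folklore] bookkeeping BY NAME over the
owner's `lineage_succ_pin_apply` ∕ `lineage_top_pin_apply` (p297335 ✓) and this lineage's rooted rows; 0 `def`, 0 cited facts, 0 `def … : Prop`, 0 sorry; NO estimate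
of Bałaban's.  Discharges NOTHING of hBdev by itself: it is the UNDRESSED part of the pair letter for births `≥ 1` (`i = 0` is free: `BornLambdaDriftSup.exists_pairZero_lam_three`);
the CONTACT part of the pair letter ((C4) cells with one slot differenced) is OPEN; NEVER «G-an2-4 closed» as (CONV-C); NOT D1, NOT `BetaPertH`, NOT continuum, NOT Clay.
Unit `b2b-balaban-gan24-formalise-leaf-06` (gen 41), 2026-08-21.
-/

noncomputable section

open Finset
open scoped BigOperators
open Literature.MathematicalPhysics.QuantumFieldTheory
open Literature.MathematicalPhysics.QuantumFieldTheory.Balaban1983to89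
open Literature.MathematicalPhysics.QuantumFieldTheory.Balaban1983to89.Beta
open ExpKernelCalculus (MKer)
open OneStepResolventKernel (Fib LocStencil)
open AffineAveraging (box toSite)
open BalabanCompositeJets (respStep)
open Summit.QuantumFields.BalabanUV.Beta.HessKerDressedUnits (unitS)
open Summit.QuantumFields.BalabanUV.Beta.GAN24.CombesThomas (sfStep smStep SupBound)
open Summit.QuantumFields.BalabanUV.Beta.GAN24.Push3 (push₃)
open Summit.QuantumFields.BalabanUV.Beta.GAN24.SrecBornSector (freshAt)
open Summit.QuantumFields.BalabanUV.Beta.GAN24.BornLambdaUndressedRow (lineage_succ_pin_apply lineage_top_pin_apply)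
open Summit.QuantumFields.BalabanUV.Beta.GAN24.S3DiffLAt (diffL_three_at)
open Summit.QuantumFields.BalabanUV.Beta.GAN24.S3DiffLtAt (diffLt_three_at)

namespace Summit.QuantumFields.BalabanUV.Beta.GAN24.BornLambdaUndressedDrift

variable {Lc : ℕ} [NeZero Lc]

/-- NOT IN PRINT; OUR BOOKKEEPING (`d = 3`, `2 ≤ Lc`, pin `cE = Lc^4`, UNCONDITIONAL).  **THE UNDRESSED TOP-ALIGNED PAIR LETTER, BIRTHS `≥ 1`, SUP CURRENCY**:
ONE `CU ≥ 0` and ONE `0 < Θ < 1` with, for every in-block root, every birth `j+1 ≥ 1`, every length `n+1 ≥ 1` and every entry,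
`|(cE·Lc^8)^{n+1}·push₃ B³_{j+2→j+n+3} X_{j+2} − (cE·Lc^8)^{n+1}·push₃ B³_{j+1→j+n+2} X_{j+1}| ≤ CU·Θ^{j+n+1}` — `Lc^4 ×` the rooted DIFF rows: `diffLt_three_at`
(`n = 0`, the K-slot's rate) and `diffL_three_at` (`n ≥ 1`, rate `max θC θK` with the extra `ρ^{n−1} ≤ 1` dropped); `Θ = max (max θL θLt) ½` so that `θ^{j+n} ≤ Θ^{j+n+1}∕Θ`. -/
theorem exists_pairU_sup_three (hLc : 2 ≤ Lc) {cE : ℝ} (hcE : cE = (Lc : ℝ) ^ (3 + 1)) (cΛ : ℝ) :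
    ∃ CU Θ : ℝ, 0 ≤ CU ∧ 0 < Θ ∧ Θ < 1 ∧ ∀ (rr : Fin (3 + 1) → ℕ), rr ∈ box (3 + 1) Lc → ∀ (j n : ℕ) (κ' : Fin (3 + 1)) (u' : Fin (3 + 1) → ℤ),
      SupBound (fun x' z' a b =>
        ((cE * (Lc : ℝ) ^ (2 * (3 + 1))) ^ (n + 1) •
            push₃ (respStep (d := 3) (Lc ^ (j + 1 + 1)) (Lc ^ (j + 1 + n + 1 + 1))) (respStep (d := 3) (Lc ^ (j + 1 + 1)) (Lc ^ (j + 1 + n + 1 + 1)))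
              (respStep (d := 3) (Lc ^ (j + 1 + 1)) (Lc ^ (j + 1 + n + 1 + 1)))
              (unitS (sfStep Lc (j + 1 + 1)) (smStep 3 Lc (j + 1 + 1)) (freshAt Lc (toSite rr) 0 cΛ (j + 1 + 1))) κ' u') x' z' a b -
          ((cE * (Lc : ℝ) ^ (2 * (3 + 1))) ^ (n + 1) •
            push₃ (respStep (d := 3) (Lc ^ (j + 1)) (Lc ^ (j + n + 1 + 1))) (respStep (d := 3) (Lc ^ (j + 1)) (Lc ^ (j + n + 1 + 1)))
              (respStep (d := 3) (Lc ^ (j + 1)) (Lc ^ (j + n + 1 + 1)))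
              (unitS (sfStep Lc (j + 1)) (smStep 3 Lc (j + 1)) (freshAt Lc (toSite rr) 0 cΛ (j + 1))) κ' u') x' z' a b)
        (CU * Θ ^ (j + n + 1)) := by
  have hLc1 : 1 ≤ Lc := le_trans one_le_two hLc
  have hL0 : (0 : ℝ) < Lc := by exact_mod_cast Nat.pos_of_ne_zero (NeZero.ne Lc)
  obtain ⟨eL, θL, ρ, hθL0, hθL1, hρ0, hρ1, hdL⟩ := diffL_three_at (Lc := Lc) hLc cΛ
  obtain ⟨cLt, θT, hcLt, hθT0, hθT1, hdLt⟩ := diffLt_three_at (Lc := Lc) hLc cΛ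
  -- the common rate, bounded away from `0`
  set Θ : ℝ := max (max θL θT) (1 / 2) with hΘ
  have hΘ0 : 0 < Θ := lt_of_lt_of_le (by norm_num) (le_max_right _ _)
  have hΘ1 : Θ < 1 := max_lt (max_lt hθL1 hθT1) (by norm_num)
  have hθLΘ : θL ≤ Θ := (le_max_left _ _).trans (le_max_left _ _)
  have hθTΘ : θT ≤ Θ := (le_max_right _ _).trans (le_max_left _ _)
  -- `eL` may be negative a priori: take `|eL|`
  refine ⟨(Lc : ℝ) ^ (3 + 1) * (|eL| + cLt) / Θ, Θ, by positivity, hΘ0, hΘ1, fun rr hrr j n κ' u' x' z' a b => ?_⟩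
  dsimp only
  rcases Nat.eq_zero_or_pos n with hn | hn
  · -- the top pair: `Lc^4 ×` row dLt at `n″ = j`
    subst hn
    have e1 := lineage_top_pin_apply (Lc := Lc) hLc1 hrr hcE cΛ (j + 1) κ' u' x' z' a b
    have e0 := lineage_top_pin_apply (Lc := Lc) hLc1 hrr hcE cΛ j κ' u' x' z' a b
    simp only [Nat.add_zero, Nat.zero_add, pow_one] at e1 e0 ⊢
    rw [e1, e0, ← mul_sub, abs_mul, abs_of_pos (pow_pos hL0 _)]
    have h := hdLt rr hrr j κ' u' x' z' a b
    dsimp only at h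
    refine (mul_le_mul_of_nonneg_left h (pow_nonneg hL0.le _)).trans ?_
    have hp : θT ^ (j + 1) ≤ Θ ^ (j + 1) := pow_le_pow_left₀ hθT0 hθTΘ _
    have hΘj : 0 ≤ Θ ^ (j + 1) := pow_nonneg hΘ0.le _
    have hL4 : 0 ≤ (Lc : ℝ) ^ (3 + 1) := pow_nonneg hL0.le _
    have hkey : (Lc : ℝ) ^ (3 + 1) * (cLt * Θ ^ (j + 1)) ≤ (Lc : ℝ) ^ (3 + 1) * (|eL| + cLt) / Θ * Θ ^ (j + 1) := by
      rw [div_mul_eq_mul_div, le_div_iff₀ hΘ0]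
      calc (Lc : ℝ) ^ (3 + 1) * (cLt * Θ ^ (j + 1)) * Θ ≤ (Lc : ℝ) ^ (3 + 1) * (cLt * Θ ^ (j + 1)) * 1 :=
            mul_le_mul_of_nonneg_left hΘ1.le (mul_nonneg hL4 (mul_nonneg hcLt hΘj))
        _ ≤ (Lc : ℝ) ^ (3 + 1) * (|eL| + cLt) * Θ ^ (j + 1) := by
            rw [mul_one]
            have : cLt ≤ |eL| + cLt := by linarith [abs_nonneg eL]
            nlinarith [mul_nonneg hL4 hΘj, mul_le_mul_of_nonneg_left this (mul_nonneg hL4 hΘj)]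
    calc (Lc : ℝ) ^ (3 + 1) * (cLt * θT ^ (j + 1)) ≤ (Lc : ℝ) ^ (3 + 1) * (cLt * Θ ^ (j + 1)) := by gcongr
      _ ≤ (Lc : ℝ) ^ (3 + 1) * (|eL| + cLt) / Θ * Θ ^ (j + 1) := hkey
  · -- a pair of length `n+1 ≥ 2`: `Lc^4 ×` row dL at `(n″, m) = (j+n, j)`
    obtain ⟨n', rfl⟩ : ∃ n', n = n' + 1 := ⟨n - 1, by omega⟩
    have e1 := lineage_succ_pin_apply (Lc := Lc) hLc1 hrr hcE cΛ (j + 1) (n' + 1) κ' u' x' z' a b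
    have e0 := lineage_succ_pin_apply (Lc := Lc) hLc1 hrr hcE cΛ j (n' + 1) κ' u' x' z' a b
    simp only [Nat.add_sub_cancel_left] at e1 e0
    rw [e1, e0, ← mul_sub, abs_mul, abs_of_pos (pow_pos hL0 _)]
    have h := hdL rr hrr (j + (n' + 1)) j (by omega) κ' u' x' z' a b
    dsimp only at h
    rw [show j + (n' + 1) - j = n' + 1 by omega, show j + (n' + 1) + 1 + 1 + 1 = j + 1 + (n' + 1) + 1 + 1 by omega] at h
    refine (mul_le_mul_of_nonneg_left h (pow_nonneg hL0.le _)).trans ?_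
    have hL4 : 0 ≤ (Lc : ℝ) ^ (3 + 1) := pow_nonneg hL0.le _
    have hp : θL ^ (j + (n' + 1) + 1) ≤ Θ ^ (j + (n' + 1) + 1) := pow_le_pow_left₀ hθL0 hθLΘ _
    have hρ : ρ ^ (n' + 1) ≤ 1 := pow_le_one₀ hρ0 hρ1.le
    have hΘj : 0 ≤ Θ ^ (j + (n' + 1) + 1) := pow_nonneg hΘ0.le _
    have hkey : (Lc : ℝ) ^ (3 + 1) * (|eL| * Θ ^ (j + (n' + 1) + 1)) ≤
        (Lc : ℝ) ^ (3 + 1) * (|eL| + cLt) / Θ * Θ ^ (j + (n' + 1) + 1) := by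
      rw [div_mul_eq_mul_div, le_div_iff₀ hΘ0]
      calc (Lc : ℝ) ^ (3 + 1) * (|eL| * Θ ^ (j + (n' + 1) + 1)) * Θ ≤ (Lc : ℝ) ^ (3 + 1) * (|eL| * Θ ^ (j + (n' + 1) + 1)) * 1 :=
            mul_le_mul_of_nonneg_left hΘ1.le (mul_nonneg hL4 (mul_nonneg (abs_nonneg _) hΘj))
        _ ≤ (Lc : ℝ) ^ (3 + 1) * (|eL| + cLt) * Θ ^ (j + (n' + 1) + 1) := by
            rw [mul_one]
            have : |eL| ≤ |eL| + cLt := by linarith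
            nlinarith [mul_nonneg hL4 hΘj, mul_le_mul_of_nonneg_left this (mul_nonneg hL4 hΘj)]
    calc (Lc : ℝ) ^ (3 + 1) * (eL * θL ^ (j + (n' + 1) + 1) * ρ ^ (n' + 1))
        ≤ (Lc : ℝ) ^ (3 + 1) * (|eL| * Θ ^ (j + (n' + 1) + 1) * 1) := by
          refine mul_le_mul_of_nonneg_left ?_ hL4
          calc eL * θL ^ (j + (n' + 1) + 1) * ρ ^ (n' + 1) ≤ |eL| * θL ^ (j + (n' + 1) + 1) * ρ ^ (n' + 1) := by
                gcongr; exact le_abs_self eL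
            _ ≤ |eL| * Θ ^ (j + (n' + 1) + 1) * 1 := by gcongr
      _ = (Lc : ℝ) ^ (3 + 1) * (|eL| * Θ ^ (j + (n' + 1) + 1)) := by rw [mul_one]
      _ ≤ (Lc : ℝ) ^ (3 + 1) * (|eL| + cLt) / Θ * Θ ^ (j + (n' + 1) + 1) := hkey
      _ = (Lc : ℝ) ^ (3 + 1) * (|eL| + cLt) / Θ * Θ ^ (j + (n' + 1) + 1) := rfl

end Summit.QuantumFields.BalabanUV.Beta.GAN24.BornLambdaUndressedDrift

end
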